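import Summits.Schanuel.Schanuel.Theorems.RootDecomp1KHyper12

/-!
# RootDecomp1KHyper — part 13 of the «HyperCarving» port wave (lens 6, gen 9 = ROUND 4 of route-Schanuel-RootDecomp1K; 19 parts planned)

Mechanical port (census-1 gen 7, dependency closure; tools census/tools/gen7/portkit2.py + build_l6g9.py) of §17 of HOME/decomp-schanuel-lens-6/g9/HyperCarving.lean
(sha256 aba5c91f…, 8041 l; critic CLEARED FOR TYPING 2026-08-30T13:33:07Z; writer PATH A″ rev 5–8) together with the §§0–16 declarations it depends on
(nothing of the node was in the tree before except RootDecomp1KLinLiouvilleSplit and the Literature fact NesterenkoWaldschmidt1996_thm_5_1).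
This part: node lines 5806–6128 (18 declarations: sb_hyperLiouville_sq, sb_three_of_one_of_hyperLiouville_coord, sb_one_hyperLiouville_any, linearIndependent_pow_succ_of_transcendental, sb_momentCurve, momentCurve_scope …).
All parts share the namespace `Summit.Schanuel.Schanuel.Theorems.RootDecomp1KHyper` (node sub-namespace `HyperCell` reproduced); statements and proofs
are the node's verbatim; `--supports stmt-Schanuel-33363` (A₄ʰ HyperLiouvilleSchanuel). Sorry-free; standard axioms. Nothing here proves Schanuel; rung 0.
-/

set_option linter.dupNamespace false
set_option linter.unusedSectionVars false

noncomputable section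

open Complex IntermediateField Filter Polynomial

namespace Summit.Schanuel.Schanuel.Theorems.RootDecomp1KHyper

variable {n K : ℕ}

namespace HyperCell

variable {n K : ℕ}

/-- §16g. Decided cells in which e^ℓ is load-bearing: auxiliary statement `ofReal_re_of_im_eq_zero` (lens 6 gen 9 node, ported verbatim). -/
private theorem ofReal_re_of_im_eq_zero {w : ℂ} (h : w.im = 0) : ((w.re : ℝ) : ℂ) = w :=
  Complex.ext (by simp) (by simp [h])

/-- **The critic's `(ℓ, ℓ²)`** for hyper-Liouville `ℓ` (mod `hX`): ℚ-free, inside the scope of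
`CoordLiouvilleSchanuel` (31077) AND of `LinLiouvilleSchanuel` (A₃), and Schanuel's bound HOLDS —
the first decided tuples of this node in which `e^ℓ` is load-bearing (the storeys of rounds 1–3
always had a MEASURED partner carrying the transcendence degree). -/
theorem sb_hyperLiouville_sq (hX : ExplicitRatExpApprox) {ℓ : ℝ} (hℓ : HyperLiouville ℓ) :
    LinearIndependent ℚ ![(ℓ : ℂ), (ℓ : ℂ) ^ 2] ∧ CoordLiouvilleSpan ![(ℓ : ℂ), (ℓ : ℂ) ^ 2] ∧
      LinLiouville ![(ℓ : ℂ), (ℓ : ℂ) ^ 2] ∧ SB 2 ![(ℓ : ℂ), (ℓ : ℂ) ^ 2] := by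
  have hsq : (ℓ : ℂ) ^ 2 = (ℓ : ℂ) * ℓ := sq _
  have hℓ0 : (ℓ : ℂ) ≠ 0 := Complex.ofReal_ne_zero.mpr hℓ.irrational.ne_zero
  refine ⟨?_, ?_, ?_, (sb_hyperLiouville_pair hX hℓ _).1⟩
  · rw [hsq]; exact linearIndependent_pair_of_irrational hℓ0 hℓ.irrational
  · exact ⟨(ℓ : ℂ), Submodule.subset_span ⟨0, by simp⟩, Or.inl (by simpa using hℓ.liouville)⟩
  · rw [hsq]; exact linLiouville_of_liouville_ratio hℓ.liouville (ℓ : ℂ)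

/-- **Cell «(1, ℓ, w)» — level 3, with `e` and `e^ℓ` load-bearing (mod `hX`).** Every
`z : Fin 3 → ℂ` with a coordinate equal to `1` and a real hyper-Liouville coordinate satisfies
Schanuel's bound `trdeg ≥ 3`: the field contains `±ℓ, e, e^{±ℓ}`. Covers the critic's `(1, ℓ, ℓ')`
for EVERY `ℓ'` (and `(ℓ, 1, w)`, `(w, ℓ, 1)`, …); for `ℓ' ∉ ℚ + ℚℓ` these tuples are ℚ-free members
of the scopes of `CoordLiouvilleSchanuel` (31077) and `LinLiouvilleSchanuel` (A₃) at `n = 3`. -/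
theorem sb_three_of_one_of_hyperLiouville_coord (hX : ExplicitRatExpApprox) {z : Fin 3 → ℂ}
    (i j : Fin 3) (hj : z j = 1) (him : (z i).im = 0) (hρ : HyperLiouville (z i).re) :
    SB 3 z := by
  have hzi : (((z i).re : ℝ) : ℂ) = z i := ofReal_re_of_im_eq_zero him
  have hmem1 : cexp 1 ∈ adjoin ℚ (SFset z ∪ {I}) :=
    mem_adjoin_SFset_I' (Or.inr ⟨j, by rw [Function.comp_apply, hj]⟩)
  have hmemz : z i ∈ adjoin ℚ (SFset z ∪ {I}) := mem_adjoin_SFset_I' (Or.inl ⟨i, rfl⟩)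
  have hmeme : cexp (z i) ∈ adjoin ℚ (SFset z ∪ {I}) := mem_adjoin_SFset_I' (Or.inr ⟨i, rfl⟩)
  rcases lt_or_gt_of_ne hρ.irrational.ne_zero with hneg | hpos
  · have hai := algebraicIndependent_three_of_hyperLiouville hX hρ.neg (neg_pos.mpr hneg)
    refine sb_of_algebraicIndependent hai (N := 3) (by simp) fun k => ?_
    fin_cases k
    · show (((-(z i).re : ℝ)) : ℂ) ∈ _
      rw [Complex.ofReal_neg, hzi]
      exact neg_mem hmemz
    · exact hmem1
    · show cexp (((-(z i).re : ℝ)) : ℂ) ∈ _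
      rw [Complex.ofReal_neg, hzi, Complex.exp_neg]
      exact inv_mem hmeme
  · have hai := algebraicIndependent_three_of_hyperLiouville hX hρ hpos
    refine sb_of_algebraicIndependent hai (N := 3) (by simp) fun k => ?_
    fin_cases k
    · show ((((z i).re : ℝ)) : ℂ) ∈ _
      rw [hzi]; exact hmemz
    · exact hmem1
    · show cexp ((((z i).re : ℝ)) : ℂ) ∈ _
      rw [hzi]; exact hmeme

/-- The critic's `(1, ℓ, ℓ')`, any `ℓ'`, for hyper-Liouville `ℓ` (mod `hX`). -/
theorem sb_one_hyperLiouville_any (hX : ExplicitRatExpApprox) {ℓ : ℝ} (hℓ : HyperLiouville ℓ)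
    (w : ℂ) : SB 3 ![(1 : ℂ), (ℓ : ℂ), w] ∧ SB 3 ![(ℓ : ℂ), (1 : ℂ), w] ∧ SB 3 ![(ℓ : ℂ), w, 1] :=
  ⟨sb_three_of_one_of_hyperLiouville_coord hX 1 0 (by simp) (by simp) (by simpa using hℓ),
    sb_three_of_one_of_hyperLiouville_coord hX 0 1 (by simp) (by simp) (by simpa using hℓ),
    sb_three_of_one_of_hyperLiouville_coord hX 0 2 (by simp) (by simp) (by simpa using hℓ)⟩

/-- Powers `x, x², …, xⁿ` of a transcendental number are `ℚ`-linearly independent. -/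
private theorem linearIndependent_pow_succ_of_transcendental {x : ℂ} (hx : Transcendental ℚ x) (n : ℕ) :
    LinearIndependent ℚ (fun i : Fin n => x ^ ((i : ℕ) + 1)) := by
  rw [Fintype.linearIndependent_iff]
  intro c hc i
  set f : ℚ[X] := ∑ j : Fin n, Polynomial.C (c j) * X ^ ((j : ℕ) + 1) with hf
  have hfx : aeval x f = 0 := by
    rw [hf, map_sum]
    simp only [map_mul, map_pow, aeval_C, aeval_X]
    rw [← hc]
    refine Finset.sum_congr rfl fun j _ => ?_
    rw [Algebra.smul_def]
  have hf0 : f = 0 := by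
    by_contra hne
    exact hx ⟨f, hne, hfx⟩
  have hcoef : f.coeff ((i : ℕ) + 1) = c i := by
    rw [hf, finsetSum_coeff]
    simp only [Polynomial.coeff_C_mul_X_pow]
    rw [Finset.sum_eq_single i]
    · rw [if_pos rfl]
    · intro j _ hj
      rw [if_neg]
      intro h; apply hj; exact Fin.ext (by omega)
    · intro h; exact absurd (Finset.mem_univ _) h
  rw [hf0, Polynomial.coeff_zero] at hcoef
  exact hcoef.symm

/-- **Cell «moment curve» — EVERY level `n`, all of `e^ℓ, e^{ℓ²}, …, e^{ℓⁿ}` load-bearing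
(mod `hX`).** For a real hyper-Liouville `ℓ` (any sign) and every `n`, Schanuel's bound holds for
`z = (ℓ, ℓ², …, ℓⁿ)`: indeed `trdeg ℚ(ℓ, e^ℓ, …, e^{ℓⁿ}) = n + 1`. These `z` are ℚ-free
(`linearIndependent_pow_succ_of_transcendental`), lie in the scope of `CoordLiouvilleSchanuel`
(31077: `z₀ = ℓ` is Liouville) and, for `n ≥ 2`, of `LinLiouvilleSchanuel` (A₃: `qz₀ − pz₁/… `;
cf. `sb_hyperLiouville_sq`), and NO measured partner is present. -/
theorem sb_momentCurve (hX : ExplicitRatExpApprox) {ℓ : ℝ} (hℓ : HyperLiouville ℓ) (n : ℕ) :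
    SB n (fun i : Fin n => (ℓ : ℂ) ^ ((i : ℕ) + 1)) := by
  rcases Nat.eq_zero_or_pos n with hn | hn
  · subst hn
    show ((0 : ℕ) : Cardinal) ≤ _
    rw [Nat.cast_zero]; exact zero_le
  set z : Fin n → ℂ := fun i => (ℓ : ℂ) ^ ((i : ℕ) + 1) with hz
  have hz0 : z ⟨0, hn⟩ = (ℓ : ℂ) := by simp [hz]
  have hmemℓ : (ℓ : ℂ) ∈ adjoin ℚ (SFset z ∪ {I}) := mem_adjoin_SFset_I' (Or.inl ⟨⟨0, hn⟩, hz0⟩)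
  have hmeme : ∀ i : Fin n, cexp ((ℓ : ℂ) ^ ((i : ℕ) + 1)) ∈ adjoin ℚ (SFset z ∪ {I}) := fun i =>
    mem_adjoin_SFset_I' (Or.inr ⟨i, rfl⟩)
  rcases lt_or_gt_of_ne hℓ.irrational.ne_zero with hneg | hpos
  · have hai := algebraicIndependent_curvePt_of_hyperLiouville hX hℓ.neg (neg_pos.mpr hneg) n
    refine sb_of_algebraicIndependent hai (by simp) fun k => ?_
    refine Fin.cases ?_ (fun i => ?_) k
    · simp only [curvePt, Fin.cons_zero]
      rw [Complex.ofReal_neg]; exact neg_mem hmemℓ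
    · simp only [curvePt, Fin.cons_succ]
      rw [Complex.ofReal_neg]
      rcases Nat.even_or_odd ((i : ℕ) + 1) with he | ho
      · rw [he.neg_pow]; exact hmeme i
      · rw [ho.neg_pow, Complex.exp_neg]; exact inv_mem (hmeme i)
  · have hai := algebraicIndependent_curvePt_of_hyperLiouville hX hℓ hpos n
    refine sb_of_algebraicIndependent hai (by simp) fun k => ?_
    refine Fin.cases ?_ (fun i => ?_) k
    · simp only [curvePt, Fin.cons_zero]; exact hmemℓ
    · simp only [curvePt, Fin.cons_succ]; exact hmeme i

/-- The moment curve lies in the scopes: ℚ-free and `CoordLiouvilleSpan` (31077's hypothesis). -/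
theorem momentCurve_scope {ℓ : ℝ} (hℓ : HyperLiouville ℓ) {n : ℕ} (hn : 0 < n) :
    LinearIndependent ℚ (fun i : Fin n => (ℓ : ℂ) ^ ((i : ℕ) + 1)) ∧
      CoordLiouvilleSpan (fun i : Fin n => (ℓ : ℂ) ^ ((i : ℕ) + 1)) := by
  refine ⟨linearIndependent_pow_succ_of_transcendental
    (transcendental_ofReal_of_liouville hℓ.liouville) n, ?_⟩
  refine ⟨(ℓ : ℂ), Submodule.subset_span ⟨⟨0, hn⟩, by simp⟩, Or.inl ?_⟩
  simpa using hℓ.liouville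

/-- `LinLiouville` only gets easier with more coordinates: if a prefix of `z` is linearly
Liouville then so is `z` (extend the integer vectors by zeros). -/
theorem linLiouville_of_prefix {k n : ℕ} (hkn : k ≤ n) {z : Fin n → ℂ}
    (h : LinLiouville (fun i : Fin k => z (Fin.castLE hkn i))) : LinLiouville z := by
  intro ω
  obtain ⟨g, hg0, hg⟩ := h ω
  have hf : Function.Injective (Fin.castLE hkn : Fin k → Fin n) := Fin.castLE_injective hkn
  set g' : Fin n → ℤ := Function.extend (Fin.castLE hkn) g 0 with hg'
  have hg'on : ∀ i : Fin k, g' (Fin.castLE hkn i) = g i := fun i => hf.extend_apply _ _ _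
  have hg'off : ∀ j : Fin n, (¬ ∃ i, Fin.castLE hkn i = j) → g' j = 0 := fun j hj => by
    rw [hg', Function.extend_apply' _ _ _ hj, Pi.zero_apply]
  -- sums over `Fin n` of functions supported on the image reduce to sums over `Fin k`
  have hsum : ∀ {M : Type} [AddCommMonoid M] (F : Fin n → M),
      (∀ j, (¬ ∃ i, Fin.castLE hkn i = j) → F j = 0) → ∑ j, F j = ∑ i, F (Fin.castLE hkn i) := by
    intro M _ F hF
    have h1 : ∑ i, F (Fin.castLE hkn i) =
        ∑ j ∈ (Finset.univ : Finset (Fin k)).map ⟨_, hf⟩, F j := by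
      rw [Finset.sum_map]; rfl
    rw [h1]
    refine (Finset.sum_subset (Finset.subset_univ _) fun j _ hj => hF j ?_).symm
    rintro ⟨i, rfl⟩
    exact hj (Finset.mem_map.mpr ⟨i, Finset.mem_univ _, rfl⟩)
  have h1 : ∑ j, (g' j : ℂ) * z j = ∑ i, (g i : ℂ) * z (Fin.castLE hkn i) := by
    rw [hsum (fun j => (g' j : ℂ) * z j) fun j hj => by simp [hg'off j hj]]
    exact Finset.sum_congr rfl fun i _ => by rw [hg'on]
  have h2 : ∑ j, (|g' j| : ℝ) = ∑ i, (|g i| : ℝ) := by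
    rw [hsum (fun j => (|g' j| : ℝ)) fun j hj => by simp [hg'off j hj]]
    exact Finset.sum_congr rfl fun i _ => by rw [hg'on]
  refine ⟨g', ?_, ?_⟩
  · intro h0
    apply hg0
    funext i
    have := congrFun h0 (Fin.castLE hkn i)
    rw [hg'on] at this
    exact this
  · rw [h1, h2]; exact hg

/-- The moment curve `(ℓ, ℓ², …, ℓⁿ)`, `n ≥ 2`, is linearly Liouville for every Liouville `ℓ`
(`q·ℓ² − p·ℓ = ℓ(qℓ − p)` is tiny): it lies in the scope of `LinLiouvilleSchanuel` (A₃). -/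
theorem linLiouville_momentCurve {ℓ : ℝ} (hℓ : Liouville ℓ) {n : ℕ} (hn : 2 ≤ n) :
    LinLiouville (fun i : Fin n => (ℓ : ℂ) ^ ((i : ℕ) + 1)) := by
  refine linLiouville_of_prefix hn ?_
  have h2 : (fun i : Fin 2 => (ℓ : ℂ) ^ (((Fin.castLE hn i : Fin n) : ℕ) + 1)) =
      ![(ℓ : ℂ), (ℓ : ℂ) * ℓ] := by
    funext i
    fin_cases i <;> simp [pow_succ]
  rw [h2]
  exact linLiouville_of_liouville_ratio hℓ (ℓ : ℂ)

/-- Scope, complete: for `n ≥ 2` the moment curve is ℚ-free, in `CoordLiouvilleSpan` (31077) AND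
`LinLiouville` (A₃ = 31986), and Schanuel's bound holds on it (mod `hX`). -/
theorem momentCurve_cell (hX : ExplicitRatExpApprox) {ℓ : ℝ} (hℓ : HyperLiouville ℓ) {n : ℕ}
    (hn : 2 ≤ n) :
    LinearIndependent ℚ (fun i : Fin n => (ℓ : ℂ) ^ ((i : ℕ) + 1)) ∧
      CoordLiouvilleSpan (fun i : Fin n => (ℓ : ℂ) ^ ((i : ℕ) + 1)) ∧
      LinLiouville (fun i : Fin n => (ℓ : ℂ) ^ ((i : ℕ) + 1)) ∧
      SB n (fun i : Fin n => (ℓ : ℂ) ^ ((i : ℕ) + 1)) :=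
  ⟨(momentCurve_scope hℓ (by omega)).1, (momentCurve_scope hℓ (by omega)).2,
    linLiouville_momentCurve hℓ.liouville hn, sb_momentCurve hX hℓ n⟩

/-- **Round-4 cut predicate** — `[z]` is a HYPER-Liouville point of ℙⁿ⁻¹: the tuple admits
non-zero integer linear forms of every EXPONENTIAL order of smallness. (The base `1 + Σ|hᵢ| ≥ 2`
rules out the degenerate witnesses `h = ±eᵢ`.) -/
def HyperLinLiouville {n : ℕ} (z : Fin n → ℂ) : Prop :=
  ∀ m : ℕ, ∃ h : Fin n → ℤ, h ≠ 0 ∧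
    ‖∑ i, (h i : ℂ) * z i‖ < Real.exp (-((1 + ∑ i, (|h i| : ℝ)) ^ m))

/-- `exp(−x) ≤ 1/x` for `x > 0`. -/
private theorem exp_neg_le_one_div {x : ℝ} (hx : 0 < x) : Real.exp (-x) ≤ 1 / x := by
  rw [Real.exp_neg, ← one_div]
  exact one_div_le_one_div_of_le hx (by linarith [Real.add_one_le_exp x])

/-- §17a. The round-4 cut predicate: auxiliary statement `exp_neg_two_pow_le` (lens 6 gen 9 node, ported verbatim). -/
private theorem exp_neg_two_pow_le (m : ℕ) : Real.exp (-(2 : ℝ) ^ m) ≤ 1 / 2 ^ m :=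
  exp_neg_le_one_div (by positivity)

/-- The hyper bound at a non-zero `h` is at most `exp(−2^m) ≤ 2^{−m}`. -/
private theorem hyper_bound_le_exp_two_pow {n : ℕ} {h : Fin n → ℤ} (hh : h ≠ 0) (m : ℕ) :
    Real.exp (-((1 + ∑ i, (|h i| : ℝ)) ^ m)) ≤ Real.exp (-(2 : ℝ) ^ m) := by
  apply Real.exp_le_exp.mpr
  have : (2 : ℝ) ^ m ≤ (1 + ∑ i, (|h i| : ℝ)) ^ m :=
    pow_le_pow_left₀ (by norm_num) (by linarith [one_le_hsum hh]) m
  linarith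

/-- The hyper bound only weakens as `m` decreases. -/
private theorem hyper_bound_mono {n : ℕ} (h : Fin n → ℤ) {m m' : ℕ} (hle : m ≤ m') :
    Real.exp (-((1 + ∑ i, (|h i| : ℝ)) ^ m')) ≤ Real.exp (-((1 + ∑ i, (|h i| : ℝ)) ^ m)) := by
  apply Real.exp_le_exp.mpr
  have h1 : (1 : ℝ) ≤ 1 + ∑ i, (|h i| : ℝ) := by linarith [hsum_nonneg h]
  linarith [pow_le_pow_right₀ h1 hle]

/-- **`HyperLinLiouville ⊆ LinLiouville`**: the round-4 cut is NESTED in the round-3 piece A₃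
(`exp(−(1+S)^m) ≤ (1+S)^{−m}`). -/
theorem HyperLinLiouville.linLiouville {n : ℕ} {z : Fin n → ℂ} (hH : HyperLinLiouville z) :
    LinLiouville z := by
  intro ω
  obtain ⟨h, hh, hlt⟩ := hH ω
  exact ⟨h, hh, hlt.trans_le (exp_neg_le_one_div (by positivity))⟩

/-- A tuple with an exact integer relation is (trivially) `HyperLinLiouville`. -/
theorem hyperLinLiouville_of_relation {n : ℕ} {z : Fin n → ℂ} {h : Fin n → ℤ} (hh : h ≠ 0)
    (h0 : ∑ i, (h i : ℂ) * z i = 0) : HyperLinLiouville z :=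
  fun m => ⟨h, hh, by rw [h0, norm_zero]; positivity⟩

/-- `HyperLinLiouville` is inherited under padding (prepend a coordinate). -/
theorem hyperLinLiouville_vecCons {n : ℕ} {z : Fin n → ℂ} (hz : HyperLinLiouville z) (w : ℂ) :
    HyperLinLiouville (Matrix.vecCons w z) := by
  intro m
  obtain ⟨h, hh, hlt⟩ := hz m
  refine ⟨Matrix.vecCons 0 h, ?_, ?_⟩
  · intro h0
    apply hh
    funext i
    have := congr_fun h0 i.succ
    simpa using this
  · simpa [Fin.sum_univ_succ] using hlt

/-- … and from any prefix (extend the integer vectors by zeros). -/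
theorem hyperLinLiouville_of_prefix {k n : ℕ} (hkn : k ≤ n) {z : Fin n → ℂ}
    (h : HyperLinLiouville (fun i : Fin k => z (Fin.castLE hkn i))) : HyperLinLiouville z := by
  intro m
  obtain ⟨g, hg0, hg⟩ := h m
  have hf : Function.Injective (Fin.castLE hkn : Fin k → Fin n) := Fin.castLE_injective hkn
  set g' : Fin n → ℤ := Function.extend (Fin.castLE hkn) g 0 with hg'
  have hg'on : ∀ i : Fin k, g' (Fin.castLE hkn i) = g i := fun i => hf.extend_apply _ _ _
  have hg'off : ∀ j : Fin n, (¬ ∃ i, Fin.castLE hkn i = j) → g' j = 0 := fun j hj => by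
    rw [hg', Function.extend_apply' _ _ _ hj, Pi.zero_apply]
  have hsum : ∀ {M : Type} [AddCommMonoid M] (F : Fin n → M),
      (∀ j, (¬ ∃ i, Fin.castLE hkn i = j) → F j = 0) → ∑ j, F j = ∑ i, F (Fin.castLE hkn i) := by
    intro M _ F hF
    have h1 : ∑ i, F (Fin.castLE hkn i) =
        ∑ j ∈ (Finset.univ : Finset (Fin k)).map ⟨_, hf⟩, F j := by
      rw [Finset.sum_map]; rfl
    rw [h1]
    refine (Finset.sum_subset (Finset.subset_univ _) fun j _ hj => hF j ?_).symm
    rintro ⟨i, rfl⟩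
    exact hj (Finset.mem_map.mpr ⟨i, Finset.mem_univ _, rfl⟩)
  have h1 : ∑ j, (g' j : ℂ) * z j = ∑ i, (g i : ℂ) * z (Fin.castLE hkn i) := by
    rw [hsum (fun j => (g' j : ℂ) * z j) fun j hj => by simp [hg'off j hj]]
    exact Finset.sum_congr rfl fun i _ => by rw [hg'on]
  have h2 : ∑ j, (|g' j| : ℝ) = ∑ i, (|g i| : ℝ) := by
    rw [hsum (fun j => (|g' j| : ℝ)) fun j hj => by simp [hg'off j hj]]
    exact Finset.sum_congr rfl fun i _ => by rw [hg'on]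
  refine ⟨g', ?_, ?_⟩
  · intro h0
    apply hg0
    funext i
    have := congrFun h0 (Fin.castLE hkn i)
    rw [hg'on] at this
    exact this
  · rw [h1, h2]; exact hg

end HyperCell

end Summit.Schanuel.Schanuel.Theorems.RootDecomp1KHyper
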